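import Summits.CriticalPhenomena.PercolationContinuityZ3.Theorems.PercNearOneGluingNoHeavyRsw3SetToSetContinuationConstants
import HarnessLib

/-!
# RSW3 lane (P2, gen 17): (A2)□ DOES NOT DEPEND ON THE MIDDLE SPHERE — `SetToSetQuasiMultAspectAt d p s L ϰ` with
# `2 ≤ s < L` implies `SetToSetQuasiMultAspectAt d p s' L' ϰ'` for EVERY `2 ≤ s' < L'`, `L ≤ L'` (every `d`; every `p`
# carrying an annulus window — in particular `p_c(ℤ^d)`, `d ≥ 2`, and every supercritical `p`)

builds on p205010 (kernel theorem, internal audit signed; external expert review pending) — NOT used in this file.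

Cell `prim-rsw3`, prover seat `prim-rsw3-p2` (gen 17), memo `run/shared/lean/prim/rsw3/P2-RSWLITE.md` §24.
Support file (`--supports stmt-CriticalPhenomena-4575`); no definitions, no named facts, no sorries.

THE QUESTION.  Basu–Sapozhnikov's hypothesis (A2) (ECP 22 (2017) no. 26, §1) is printed with the spheres `S(v,2m)`
between `B(v,m) ∋ X` and `Z ∖ B(v,4m) ∋ Y`; the lane's box form `Crossing.SetToSetQuasiMultAspectAt d p s L ϰ`
(defs v5) carries a general aspect `(s, L)`: `ϰ · P[X ↔ ∂ⁱⁿΛ(sm) in Z] · P[Y ↔ ∂ⁱⁿΛ(sm) in Z] ≤ P[X ↔ Y in Z]` for all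
`m ≥ 1`, finite `Z ⊇ Λ(Lm) ∖ Λ(m-1)`, `X ⊆ Z ∩ Λ(m)`, `Y ⊆ Z ∖ Λ(Lm)`.  Enlarging `L` weakens it
(`SetToSetQuasiMultAspectAt.mono_outer`); the defs file records "moving `s` is an RSW-type step" (OPEN), and the lane's
reductions land at various aspects ((2,4) printed; CU_l / (A2′)_l at `(l, l²)`, p1 gen 3; `(12,144)` for the printed
graph-metric (A2), p2 gen 16).

THE ANSWER (this file).  The RSW-type step is supplied by (A2)□ ITSELF: **for `2 ≤ s < L`, `ϰ > 0`, `0 < p`, and an annulus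
window at aspect `s` (`∃ u₀ > 0 ∀ n ≥ 1, u₀ ≤ P_p(Λ(n) ↔ ∂ⁱⁿΛ(sn) in Λ(sn))`), `SetToSetQuasiMultAspectAt d p s L ϰ` implies
`∃ ϰ' > 0, SetToSetQuasiMultAspectAt d p s' L' ϰ'` for every `2 ≤ s' < L'` with `L ≤ L'`**
(`exists_setToSetQuasiMultAspectAt_of_window`).  At `p = p_c(ℤ^d)`, `d ≥ 2`, the window is the tree's
`Rsw3.le_real_boxCrossing_mul_criticalProbI` (every aspect), so the conclusion is unconditional in the window
(`exists_setToSetQuasiMultAspectAt_criticalProbI_of_aspect`); above `p_c` the window is `θ(p) > 0`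
(`exists_setToSetQuasiMultAspectAt_of_theta_pos`).  Consequences: at a fixed outer aspect `L ≥ 3` all middle spheres
`2 ≤ s < L` are EQUIVALENT (`exists_setToSetQuasiMultAspectAt_criticalProbI_iff`; `s = 1` is false,
`Crossing.not_setToSetQuasiMultAspectAt_one`), so the (A2)□ family at `p_c` is a single chain ordered by `L`; the printed
`SetToSetQuasiMult` (`(2,4)` on `ℤ³`) gives every `(s', L')` with `L' ≥ 4`
(`exists_setToSetQuasiMultAspectAt_of_setToSetQuasiMult`); and a hypothesis at `(s, L)` gives the printed INNER aspect
`(2, L')` for every `L' ≥ L` (`exists_setToSetQuasiMultAspectAt_two_criticalProbI`).  The OUTER aspect `L` cannot be lowered by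
this method: for `L' < L` the region `Λ(Lm) ∖ Λ(L'm)` where `Y` may live and `Z` may have holes is invisible to the
hypothesis (recorded in the memo as the exact wall).

MECHANISM (parts I, IIa, IIb, III of this gen; the constants are `Rsw3.exists_inward_continuation_const` / `…_outward_…` of part III).  Apply the hypothesis at `(m, Z, X, Y)`; then replace the sphere `∂ⁱⁿΛ(sm)` by
`∂ⁱⁿΛ(s'm)` in the two factors.  One factor is free (first exit / first entry: an arm to the farther sphere passes the nearer
one).  The other is an ARM CONTINUATION with an `m`-independent constant: for `m ≥ D = L + s + L'` by the radial
(A2)□-chains of part IIb at the small scale `n = ⌊m/D⌋` (inward for the outer set `Y` when `s < s'`, outward for the inner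
set `X` when `s' < s`), for `m < D` by the brute-force shell lemmas of part I (all edges of the shell open, Harris).

References: D. Basu, A. Sapozhnikov, *Kesten's incipient infinite cluster and quasi-multiplicativity of crossing
probabilities*, Electron. Commun. Probab. 22 (2017) no. 26, §1 (A2), Thm. 1.1, §3 [BasuSapozhnikov2017ECP];
H. Kesten, *Percolation Theory for Mathematicians* (1982), Cor. 5.1 (the critical annulus window) [Kesten1982];
G. Grimmett, *Percolation* (1999), §11.7 [GrimmettPercolation1999]. [folklore]
-/

noncomputable section

namespace Summit.CriticalPhenomena.PercolationContinuityZ3.Theorems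

namespace Rsw3

open MeasureTheory Literature.Probability.LatticeModels Literature.Probability.Percolation
open SurfaceTension Crossing SimpleGraph

variable {d : ℕ}

/-! ## The theorem -/

/-- **(A2)□ DOES NOT DEPEND ON THE MIDDLE SPHERE** (every `d`; every `p > 0` with an annulus window at aspect `s`).
For `2 ≤ s < L`, `ϰ > 0`, if `SetToSetQuasiMultAspectAt d p s L ϰ` holds and
`∃ u₀ > 0, ∀ n ≥ 1, u₀ ≤ P_p(Λ(n) ↔ ∂ⁱⁿΛ(sn) in Λ(sn))`, then for every `2 ≤ s' < L'` with `L ≤ L'` there is `ϰ' > 0` with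
`SetToSetQuasiMultAspectAt d p s' L' ϰ'`.  (The outer aspect only weakens; the middle sphere is free.)
[cite: BasuSapozhnikov2017ECP, §1 assumption (A2)] [cite: Kesten1982, Cor. 5.1] -/
theorem exists_setToSetQuasiMultAspectAt_of_window {p : unitInterval} {s L : ℕ} {ϰ u₀ : ℝ}
    (h : SetToSetQuasiMultAspectAt d p s L ϰ) (hϰ : 0 < ϰ) (hs : 2 ≤ s) (hsL : s < L) (hp : 0 < (p : ℝ))
    (hu₀ : 0 < u₀) (hu : ∀ n : ℕ, 1 ≤ n → u₀ ≤ (bondPercolation (zdGraph d) p).real (boxCrossing d n (s * n)))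
    {s' L' : ℕ} (hs' : 2 ≤ s') (hs'L' : s' < L') (hLL' : L ≤ L') :
    ∃ ϰ' : ℝ, 0 < ϰ' ∧ SetToSetQuasiMultAspectAt d p s' L' ϰ' := by
  -- WLOG `ϰ ≤ 1`
  set ϰ₁ : ℝ := min ϰ 1 with hϰ₁
  have h₁ : SetToSetQuasiMultAspectAt d p s L ϰ₁ := setToSetQuasiMultAspectAt_of_le (min_le_left ϰ 1) h
  have hϰ₁0 : 0 < ϰ₁ := lt_min hϰ one_pos
  have hϰ₁1 : ϰ₁ ≤ 1 := min_le_right ϰ 1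
  rcases le_or_gt s s' with hss' | hs's
  · -- move the sphere OUTWARDS: continue the outer set's arm inwards
    obtain ⟨κ, hκ, hc⟩ := exists_inward_continuation_const h₁ hϰ₁0 hϰ₁1 hs hsL hss' hs'L' hLL' hp hu₀ hu
    refine ⟨ϰ₁ * κ, mul_pos hϰ₁0 hκ, setToSetQuasiMultAspectAt_of_continuation h₁ hϰ₁0.le hLL' ?_⟩
    intro m hm Z hZ X hX Y hY
    have hXm : X ⊆ box d m := fun x hx => (Finset.mem_inter.1 (hX hx)).2
    have hsm : m ≤ s * m := Nat.le_mul_of_pos_left m (by omega)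
    -- inner factor: free (or equal)
    have hXf : (bondPercolation (zdGraph d) p).real
          (openCrossing (↑Z : Set (Site d)) ↑X ↑(innerBoundary (zdGraph d) (box d (s' * m)))) ≤
        (bondPercolation (zdGraph d) p).real
          (openCrossing (↑Z : Set (Site d)) ↑X ↑(innerBoundary (zdGraph d) (box d (s * m)))) := by
      rcases (Nat.mul_le_mul_right m hss').eq_or_lt with he | hlt
      · rw [he]
      · exact real_openCrossing_innerBoundary_anti_of_inner p hsm hlt hXm
    have hYf := hc m hm Z Y hZ hY
    calc κ * ((bondPercolation (zdGraph d) p).real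
            (openCrossing (↑Z : Set (Site d)) ↑X ↑(innerBoundary (zdGraph d) (box d (s' * m)))) *
          (bondPercolation (zdGraph d) p).real
            (openCrossing (↑Z : Set (Site d)) ↑Y ↑(innerBoundary (zdGraph d) (box d (s' * m)))))
        = (bondPercolation (zdGraph d) p).real
            (openCrossing (↑Z : Set (Site d)) ↑X ↑(innerBoundary (zdGraph d) (box d (s' * m)))) *
          (κ * (bondPercolation (zdGraph d) p).real
            (openCrossing (↑Z : Set (Site d)) ↑Y ↑(innerBoundary (zdGraph d) (box d (s' * m))))) := by ring
      _ ≤ (bondPercolation (zdGraph d) p).real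
            (openCrossing (↑Z : Set (Site d)) ↑X ↑(innerBoundary (zdGraph d) (box d (s * m)))) *
          (bondPercolation (zdGraph d) p).real
            (openCrossing (↑Z : Set (Site d)) ↑Y ↑(innerBoundary (zdGraph d) (box d (s * m)))) :=
          mul_le_mul hXf hYf (mul_nonneg hκ.le measureReal_nonneg) measureReal_nonneg
  · -- move the sphere INWARDS: continue the inner set's arm outwards
    obtain ⟨κ, hκ, hc⟩ := exists_outward_continuation_const h₁ hϰ₁0 hϰ₁1 hs hsL hs' hs's.le hLL' hp hu₀ hu
    refine ⟨ϰ₁ * κ, mul_pos hϰ₁0 hκ, setToSetQuasiMultAspectAt_of_continuation h₁ hϰ₁0.le hLL' ?_⟩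
    intro m hm Z hZ X hX Y hY
    -- outer factor: free
    have hYout : ∀ y ∈ Y, y ∉ box d (s * m) := by
      intro y hy h'
      exact (Finset.mem_sdiff.1 (hY hy)).2 (box_mono d (Nat.mul_le_mul_right m (by omega)) h')
    have hYf : (bondPercolation (zdGraph d) p).real
          (openCrossing (↑Z : Set (Site d)) ↑Y ↑(innerBoundary (zdGraph d) (box d (s' * m)))) ≤
        (bondPercolation (zdGraph d) p).real
          (openCrossing (↑Z : Set (Site d)) ↑Y ↑(innerBoundary (zdGraph d) (box d (s * m)))) :=
      real_openCrossing_innerBoundary_mono_of_outer p (Nat.mul_le_mul_right m hs's.le) hYout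
    have hXf := hc m hm Z X hZ hX
    calc κ * ((bondPercolation (zdGraph d) p).real
            (openCrossing (↑Z : Set (Site d)) ↑X ↑(innerBoundary (zdGraph d) (box d (s' * m)))) *
          (bondPercolation (zdGraph d) p).real
            (openCrossing (↑Z : Set (Site d)) ↑Y ↑(innerBoundary (zdGraph d) (box d (s' * m)))))
        = κ * (bondPercolation (zdGraph d) p).real
            (openCrossing (↑Z : Set (Site d)) ↑X ↑(innerBoundary (zdGraph d) (box d (s' * m)))) *
          (bondPercolation (zdGraph d) p).real
            (openCrossing (↑Z : Set (Site d)) ↑Y ↑(innerBoundary (zdGraph d) (box d (s' * m)))) := by ring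
      _ ≤ (bondPercolation (zdGraph d) p).real
            (openCrossing (↑Z : Set (Site d)) ↑X ↑(innerBoundary (zdGraph d) (box d (s * m)))) *
          (bondPercolation (zdGraph d) p).real
            (openCrossing (↑Z : Set (Site d)) ↑Y ↑(innerBoundary (zdGraph d) (box d (s * m)))) :=
          mul_le_mul hXf hYf measureReal_nonneg measureReal_nonneg

/-! ## At `p_c(ℤ^d)`, `d ≥ 2`: the window is a theorem, so the middle sphere is free unconditionally -/

/-- **(A2)□ at `p_c(ℤ^d)` does not depend on the middle sphere** (`d ≥ 2`): for `2 ≤ s < L`, `ϰ > 0`,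
`SetToSetQuasiMultAspectAt d p_c s L ϰ` implies `∃ ϰ' > 0, SetToSetQuasiMultAspectAt d p_c s' L' ϰ'` for every
`2 ≤ s' < L'` with `L ≤ L'`; the window at aspect `s` is Kesten's critical annulus bound (the tree's
`Rsw3.le_real_boxCrossing_mul_criticalProbI`) and `p_c(ℤ^d) > 0`.
[cite: BasuSapozhnikov2017ECP, §1 assumption (A2)] [cite: Kesten1982, Cor. 5.1] -/
theorem exists_setToSetQuasiMultAspectAt_criticalProbI_of_aspect (hd : 2 ≤ d) {s L : ℕ} {ϰ : ℝ}
    (h : SetToSetQuasiMultAspectAt d (criticalProbI d) s L ϰ) (hϰ : 0 < ϰ) (hs : 2 ≤ s) (hsL : s < L)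
    {s' L' : ℕ} (hs' : 2 ≤ s') (hs'L' : s' < L') (hLL' : L ≤ L') :
    ∃ ϰ' : ℝ, 0 < ϰ' ∧ SetToSetQuasiMultAspectAt d (criticalProbI d) s' L' ϰ' := by
  have hpc : 0 < ((criticalProbI d : unitInterval) : ℝ) := by
    rw [coe_criticalProbI]; exact criticalProb_zd_pos d (by omega)
  have hu₀ : 0 < (2 * (d : ℝ))⁻¹ * ((4 * (s : ℝ)) ^ (d - 1))⁻¹ := by
    have : (0 : ℝ) < d := by exact_mod_cast (show 0 < d by omega)
    have : (0 : ℝ) < s := by exact_mod_cast (show 0 < s by omega)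
    positivity
  exact exists_setToSetQuasiMultAspectAt_of_window h hϰ hs hsL hpc hu₀
    (fun n hn => le_real_boxCrossing_mul_criticalProbI hd (by omega) hn) hs' hs'L' hLL'

/-- **Middle spheres are equivalent at `p_c(ℤ^d)`** (`d ≥ 2`, fixed outer aspect `L`): for `2 ≤ s, s' < L`,
`(∃ ϰ > 0, SetToSetQuasiMultAspectAt d p_c s L ϰ) ↔ (∃ ϰ > 0, SetToSetQuasiMultAspectAt d p_c s' L ϰ)`.
(`s = 1` is excluded for good reason: `Crossing.not_setToSetQuasiMultAspectAt_one`.)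
[cite: BasuSapozhnikov2017ECP, §1 assumption (A2)] -/
theorem exists_setToSetQuasiMultAspectAt_criticalProbI_iff (hd : 2 ≤ d) {s s' L : ℕ} (hs : 2 ≤ s) (hsL : s < L)
    (hs' : 2 ≤ s') (hs'L : s' < L) :
    (∃ ϰ : ℝ, 0 < ϰ ∧ SetToSetQuasiMultAspectAt d (criticalProbI d) s L ϰ) ↔
      (∃ ϰ : ℝ, 0 < ϰ ∧ SetToSetQuasiMultAspectAt d (criticalProbI d) s' L ϰ) :=
  ⟨fun ⟨_, hϰ, h⟩ => exists_setToSetQuasiMultAspectAt_criticalProbI_of_aspect hd h hϰ hs hsL hs' hs'L le_rfl,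
    fun ⟨_, hϰ, h⟩ => exists_setToSetQuasiMultAspectAt_criticalProbI_of_aspect hd h hϰ hs' hs'L hs hsL le_rfl⟩

/-- **Back to the printed inner aspect**: at `p_c(ℤ^d)` (`d ≥ 2`), (A2)□ at any `(s, L)` with `2 ≤ s < L` gives (A2)□ with
middle sphere `∂ⁱⁿΛ(2m)` and outer box `Λ(L'm)` for every `L' ≥ L` — e.g. the lane's CU_l / (A2′)_l landings at `(l, l²)`
(p1 gen 3) yield `(2, L')` for all `L' ≥ l²`. [cite: BasuSapozhnikov2017ECP, §1 assumption (A2)] -/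
theorem exists_setToSetQuasiMultAspectAt_two_criticalProbI (hd : 2 ≤ d) {s L : ℕ} {ϰ : ℝ}
    (h : SetToSetQuasiMultAspectAt d (criticalProbI d) s L ϰ) (hϰ : 0 < ϰ) (hs : 2 ≤ s) (hsL : s < L)
    {L' : ℕ} (hLL' : L ≤ L') :
    ∃ ϰ' : ℝ, 0 < ϰ' ∧ SetToSetQuasiMultAspectAt d (criticalProbI d) 2 L' ϰ' :=
  exists_setToSetQuasiMultAspectAt_criticalProbI_of_aspect hd h hϰ hs hsL le_rfl (by omega) hLL'

/-- **`ℤ³`, the printed hypothesis**: `SetToSetQuasiMult` (Basu–Sapozhnikov's (A2) at `p_c(ℤ³)`, aspect `(2,4)`) implies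
(A2)□ at EVERY aspect `(s', L')` with `2 ≤ s' < L'`, `4 ≤ L'`. [cite: BasuSapozhnikov2017ECP, §1 assumption (A2)] -/
theorem exists_setToSetQuasiMultAspectAt_of_setToSetQuasiMult (h : SetToSetQuasiMult) {s' L' : ℕ} (hs' : 2 ≤ s')
    (hs'L' : s' < L') (hL' : 4 ≤ L') :
    ∃ ϰ' : ℝ, 0 < ϰ' ∧ SetToSetQuasiMultAspectAt 3 (criticalProbI 3) s' L' ϰ' := by
  obtain ⟨ϰ, hϰ, hA2⟩ := h
  rw [setToSetQuasiMultAt_iff_aspect] at hA2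
  exact exists_setToSetQuasiMultAspectAt_criticalProbI_of_aspect (by norm_num) hA2 hϰ le_rfl (by norm_num) hs' hs'L' hL'

/-! ## Above `p_c`: the window is `θ(p) > 0` -/

/-- **Percolating `p`**: if `θ(p) > 0` (e.g. `p > p_c(ℤ^d)`) then for `2 ≤ s < L`, `ϰ > 0`, (A2)□ at `(s, L)` implies (A2)□ at
every `(s', L')` with `2 ≤ s' < L'`, `L ≤ L'`: the window is `θ(p) ≤ P_p(Λ(n) ↔ ∂ⁱⁿΛ(sn) in Λ(sn))`
(`Rsw3.theta_le_real_boxCrossing`). [cite: BasuSapozhnikov2017ECP, §1 assumption (A2)] -/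
theorem exists_setToSetQuasiMultAspectAt_of_theta_pos {p : unitInterval} (hθ : 0 < theta (zdGraph d) 0 p) {s L : ℕ}
    {ϰ : ℝ} (h : SetToSetQuasiMultAspectAt d p s L ϰ) (hϰ : 0 < ϰ) (hs : 2 ≤ s) (hsL : s < L)
    {s' L' : ℕ} (hs' : 2 ≤ s') (hs'L' : s' < L') (hLL' : L ≤ L') :
    ∃ ϰ' : ℝ, 0 < ϰ' ∧ SetToSetQuasiMultAspectAt d p s' L' ϰ' := by
  have hp : 0 < (p : ℝ) := by
    by_contra hle
    push Not at hle
    have hp0 : (p : ℝ) = 0 := le_antisymm hle p.2.1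
    have hθ0 : theta (zdGraph d) 0 p = 0 := by
      have hp' : p = 0 := Subtype.ext hp0
      rw [hp']
      exact theta_bot (zdGraph d) 0
    linarith
  exact exists_setToSetQuasiMultAspectAt_of_window h hϰ hs hsL hp hθ
    (fun n hn => theta_le_real_boxCrossing p (Nat.le_mul_of_pos_left n (by omega))) hs' hs'L' hLL'

end Rsw3

end Summit.CriticalPhenomena.PercolationContinuityZ3.Theorems
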